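import Mathlib.GroupTheory.SemidirectProduct
import Mathlib.LinearAlgebra.Matrix.GeneralLinearGroup.Defs
import Mathlib.LinearAlgebra.Matrix.SpecialLinearGroup
import Mathlib.LinearAlgebra.Matrix.ToLin
import Mathlib.LinearAlgebra.Semisimple
import Mathlib.Algebra.MvPolynomial.Basic
import Mathlib.Topology.Algebra.Group.Basic
import Mathlib.Topology.Instances.Matrix
import Mathlib.Analysis.Complex.Basic
import Mathlib.FieldTheory.AbsoluteGaloisGroup
import Mathlib.RepresentationTheory.Irreducible
import Literature.NumberTheory.GaloisRepresentations.AbsGaloisGroup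
import Literature.NumberTheory.GaloisRepresentations.WeilGroup
import Literature.NumberTheory.GaloisRepresentations.WeilDeligneRep
import HarnessLib

-- provenance: harness21/H21/H21/Prelude/AutomorphicAxiomatic/LParameter.lean @ 4354252 (interim HEAD d8f2665); M5 mechanical rewrite
/-!
# L-groups and L-parameters (trunk AutomorphicAxiomatic, item C5; notion `l_parameter`)

Let `F` be a non-archimedean local field with absolute Galois group `Γ_F` and Weil group
`W_F` (`Literature.WeilGroup F`, item G09).  An *L-group datum* is a complex linear group `Ĝ ≤ GL_N(ℂ)`
(every complex reductive group is linear, so nothing is lost) together with an action of `Γ_F`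
on `Ĝ` by automorphisms factoring through a finite (open-kernel) quotient; the *L-group* is
`ᴸG = Ĝ ⋊ Γ_F` (Borel, *Automorphic L-functions*, Corvallis 1979, §2).  An *L-parameter* is
(the `SL₂`-form of) an admissible homomorphism `W_F × SL₂(ℂ) → ᴸG`: a homomorphism
`φ : W_F → ᴸG` over `Γ_F`, continuous (trivial on an open subgroup of inertia), with
Frobenius-semisimple image, together with a commuting algebraic `θ : SL₂(ℂ) → Ĝ`
(Borel, Corvallis 1979, §8.2; Gross–Reeder, *Duke Math. J.* 154 (2010), §3; Kaletha,
*The local Langlands conjectures for non-quasi-split groups* (2016), §5).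

## Contents

* `LGroupData F`, `LGroupData.LGroup`, `LGroupData.gl`, `LGroupData.IsSplit`,
  `LGroupData.centerFixed` (`Z(Ĝ)^Γ`).
* `IsPolynomialHom θ` (algebraicity of `θ : SL₂(ℂ) → Ĝ`), `LParameter L`, conjugation
  `LParameter.conj`, equivalence `LParameter.IsEquiv` / `LParameter.setoid`, `IsUnramified`,
  `IsBounded` (tempered), `centralizerGroup` (`S_φ`), `IsDiscrete`, `componentGroup`
  (`π₀(S_φ)`), `EnhancedLParameter`.
* The `GL_n` dictionary: `frobSemisimpleWDSetoid`, `LParameter.gl_equiv_weilDeligneRep`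
  (L-parameters for `GL_n` ↔ Frobenius-semisimple Weil–Deligne representations, Gross–Reeder
  2010, §2; Deligne 1973, §8), `LParameter.componentGroup_subsingleton_of_gl` — both **named
  facts** (`def … : Prop`, D-0014), to be taken as hypotheses by consumers.
* Complement to G09: `WeilGroup.continuous_toAbsGalois_holds` discharges the named fact
  `WeilGroup.continuous_toAbsGalois` (continuity of `W_F → Γ_F`, Tate (1.4.1)) directly from the
  definition of the Weil topology.

## Mathlib search

Mathlib (this pin) has `SemidirectProduct`, `MulAut`, `Matrix.GeneralLinearGroup`,
`Matrix.SpecialLinearGroup`, `Module.End.IsSemisimple`, `LinearEquiv.isSemisimple_iff`,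
`Subgroup.centralizer`, `Subgroup.connectedComponentOfOne` (no `Normal` instance: proved here as
`connectedComponentOfOne_normal`), `FixedPoints.subgroup`, `Representation.IsIrreducible`,
`Field.absoluteGaloisGroup`; it has no L-groups, L-parameters or Weil groups.  Nothing here
duplicates a Mathlib declaration.  `Literature.NumberTheory.GaloisRepresentations.WeilDeligneRep.Equiv.trans` (missing from the accepted
G09 file, which has `refl`/`symm`) is added in the `Literature.NumberTheory.GaloisRepresentations.WeilDeligneRep` namespace (deliberate
dot-notation extension of an H21 declaration).

## Design choices

* `Ĝ` is a `Subgroup (GL (Fin rank) ℂ)` (a complex *linear* group) rather than an abstract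
  algebraic group: this is what the statements consume (semisimplicity of Frobenius, boundedness,
  the topology on `S_φ`), and every complex reductive group admits a faithful representation.
* The Galois action has open kernel (`isOpen_ker`), i.e. factors through `Gal(E/F)` for a finite
  Galois `E/F` (Borel §2.4: one may replace `Γ_F` by such a quotient).
* Frobenius-semisimplicity is phrased without choosing a Frobenius: whenever a power `(φ w)^m`
  has Galois component acting trivially on `Ĝ`, its `Ĝ`-component is a semisimple matrix.
* `IsBounded` takes the closure of the image of `W_F` in `GL_N(ℂ)`.
* Relevance of parameters (Borel §8.2(ii)) and Kaletha's rigid enhancement `S_φ^+` are omitted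
  in v0; `EnhancedLParameter` uses `π₀(S_φ)` (Arthur's / Gross–Reeder's component group).
-/

noncomputable section

open Field Matrix
open scoped MatrixGroups

namespace Literature.NumberTheory.Automorphic

/-! ### Complement to G09: transitivity of equivalence of Weil–Deligne representations -/

section WeilDeligneRep
open Literature.NumberTheory.GaloisRepresentations (WeilDeligneRep)
open Literature.NumberTheory.GaloisRepresentations.WeilDeligneRep

variable {F : Type*} [Field F] [ValuativeRel F] [TopologicalSpace F] [IsNonarchimedeanLocalField F]
variable {C : Type*} [Field C] [CharZero C] {V V' V'' : Type*} [AddCommGroup V] [Module C V]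
  [AddCommGroup V'] [Module C V'] [AddCommGroup V''] [Module C V'']
variable {r : WeilDeligneRep F C V} {r' : WeilDeligneRep F C V'} {r'' : WeilDeligneRep F C V''}

/-- Composition of isomorphisms of Weil–Deligne representations.
Ref: Deligne, *Les constantes des équations fonctionnelles* (Antwerp II, 1973), §8.4.1. [cite: II1973] -/
protected def _root_.Literature.NumberTheory.GaloisRepresentations.WeilDeligneRep.Equiv.trans (e : WeilDeligneRep.Equiv r r') (e' : WeilDeligneRep.Equiv r' r'') : WeilDeligneRep.Equiv r r'' where
  __ := e.toRepEquiv.trans e'.toRepEquiv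
  comm_N := by
    change (e'.toLinearMap ∘ₗ e.toLinearMap) ∘ₗ r.N = r''.N ∘ₗ (e'.toLinearMap ∘ₗ e.toLinearMap)
    rw [LinearMap.comp_assoc, e.comm_N, ← LinearMap.comp_assoc, e'.comm_N, LinearMap.comp_assoc]

/-- `IsEquivalent` is reflexive.  Ref: Deligne, Antwerp II (1973), §8.4.1. [cite: II1973] -/
protected theorem _root_.Literature.NumberTheory.GaloisRepresentations.WeilDeligneRep.IsEquivalent.refl (r : WeilDeligneRep F C V) : r.IsEquivalent r :=
  ⟨WeilDeligneRep.Equiv.refl r⟩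

/-- `IsEquivalent` is symmetric.  Ref: Deligne, Antwerp II (1973), §8.4.1. [cite: II1973] -/
protected theorem _root_.Literature.NumberTheory.GaloisRepresentations.WeilDeligneRep.IsEquivalent.symm (h : r.IsEquivalent r') : r'.IsEquivalent r :=
  ⟨h.some.symm⟩

/-- `IsEquivalent` is transitive.  Ref: Deligne, Antwerp II (1973), §8.4.1. [cite: II1973] -/
protected theorem _root_.Literature.NumberTheory.GaloisRepresentations.WeilDeligneRep.IsEquivalent.trans (h : r.IsEquivalent r') (h' : r'.IsEquivalent r'') :
    r.IsEquivalent r'' :=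
  ⟨h.some.trans h'.some⟩

end WeilDeligneRep

/-! ### Complement to G09: continuity of `W_F → Γ_F` (discharge of a named fact) -/

section WeilGroup
open Literature.NumberTheory.GaloisRepresentations (WeilGroup)
open Literature.NumberTheory.GaloisRepresentations.WeilGroup

variable (F : Type*) [Field F] [ValuativeRel F] [TopologicalSpace F] [IsNonarchimedeanLocalField F]

/-- Discharge of the named fact `WeilGroup.continuous_toAbsGalois` (Tate, *Number theoretic
background*, Corvallis 1979, (1.4.1)): the inclusion `W_F → Gal(F̄/F)` is continuous for the Weil
topology `WeilGroup.instTopologicalSpace`, because the preimage of an open `V ⊆ Γ_F` is the union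
over `w ∈ W_F` of the generating open sets `{x | x w⁻¹ ∈ I_F ∧ x ∈ V}` (take `w = x`).  Used by
`LParameter.conj` below. [folklore] -/
theorem _root_.Literature.NumberTheory.GaloisRepresentations.WeilGroup.continuous_toAbsGalois_holds : continuous_toAbsGalois F := by
  unfold continuous_toAbsGalois
  refine continuous_def.2 fun V hV => ?_
  have hpre : toAbsGalois F ⁻¹' V =
      ⋃ w : WeilGroup F, {x | x * w⁻¹ ∈ inertia F ∧ toAbsGalois F x ∈ V} := by
    ext x
    simp only [Set.mem_preimage, Set.mem_iUnion, Set.mem_setOf_eq]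
    exact ⟨fun hx => ⟨x, by rw [mul_inv_cancel]; exact one_mem _, hx⟩, fun ⟨_, _, hx⟩ => hx⟩
  rw [hpre]
  exact isOpen_iUnion fun w => TopologicalSpace.isOpen_generateFrom_of_mem ⟨w, V, hV, rfl⟩

end WeilGroup

/-! ### Two general lemmas -/

/-- The identity component `G°` of a topological group is a normal subgroup (conjugation is a
homeomorphism fixing `1`).  Mathlib has `Subgroup.connectedComponentOfOne` but no `Normal`
instance for it.  Ref: Bourbaki, *Topologie générale*, III §2.2, Prop. 7. [folklore] -/
instance connectedComponentOfOne_normal (G : Type*) [TopologicalSpace G] [Group G]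
    [IsTopologicalGroup G] : (Subgroup.connectedComponentOfOne G).Normal where
  conj_mem n hn g := by
    have hc : Continuous fun x : G => g * x * g⁻¹ := by fun_prop
    have h := hc.image_connectedComponent_subset (1 : G)
    simp only [mul_one, mul_inv_cancel] at h
    exact h ⟨n, hn, rfl⟩

/-- Semisimplicity of an endomorphism of `n → K` given by a matrix is invariant under conjugation
by an invertible matrix (`LinearEquiv.isSemisimple_iff`).
Ref: Bourbaki, *Algèbre* VII §5.8. [folklore] -/
theorem isSemisimple_toLin'_units_conj_iff {n : Type*} [Fintype n] [DecidableEq n] {K : Type*}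
    [Field K] (g : GL n K) (A : Matrix n n K) :
    Module.End.IsSemisimple
      (Matrix.toLin' ((g : Matrix n n K) * A * ((g⁻¹ : GL n K) : Matrix n n K))) ↔
      Module.End.IsSemisimple (Matrix.toLin' A) := by
  refine (LinearEquiv.isSemisimple_iff (Matrix.toLin' A) _
    (Matrix.toLin'OfInv (Units.inv_mul g) (Units.mul_inv g)) ?_).symm
  change Matrix.toLin' (g : Matrix n n K) ∘ₗ Matrix.toLin' A = _ ∘ₗ Matrix.toLin' (g : Matrix n n K)
  rw [← Matrix.toLin'_mul, ← Matrix.toLin'_mul, mul_assoc _ _ (g : Matrix n n K), Units.inv_mul,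
    mul_one]

section Automorphic

section LGroup

/-! ### L-groups

Only the field structure of `F` is used in this section (`Γ_F = Field.absoluteGaloisGroup F`). -/

variable (F : Type*) [Field F]

/-- An **L-group datum** over the non-archimedean local field `F`: a complex linear group
`Ĝ = dual ≤ GL_rank(ℂ)` (the complex dual group; every complex reductive group is linear) with
an action `galAct` of `Γ_F = Gal(F̄/F)` on `Ĝ` by group automorphisms whose kernel is open
(so the action factors through a finite Galois group `Gal(E/F)`).  This is a hypothesis
structure: root data and pinnings are not recorded.
Ref: Borel, *Automorphic L-functions* (Corvallis 1979), §§2.1–2.4. [cite: Corvallis1979] -/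
structure LGroupData where
  /-- The size of the ambient general linear group. -/
  rank : ℕ
  /-- The complex dual group `Ĝ(ℂ) ≤ GL_rank(ℂ)`. -/
  dual : Subgroup (GL (Fin rank) ℂ)
  /-- The action of `Γ_F` on `Ĝ` by automorphisms. -/
  galAct : absoluteGaloisGroup F →* MulAut dual
  /-- The Galois action factors through a finite quotient. -/
  isOpen_ker : IsOpen (galAct.ker : Set (absoluteGaloisGroup F))

namespace LGroupData

variable {F}

/-- The (Galois form of the) **L-group** `ᴸG = Ĝ ⋊ Γ_F` of an L-group datum (Mathlib
`SemidirectProduct`; an `abbrev`, so that `SemidirectProduct.inl/inr/left/right` and the group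
structure apply directly).  Ref: Borel, *Automorphic L-functions* (Corvallis 1979), §2.4. [cite: Corvallis1979] -/
abbrev LGroup (L : LGroupData F) : Type _ :=
  L.dual ⋊[L.galAct] absoluteGaloisGroup F

variable (F) in
/-- The L-group datum of `GL_n`: `Ĝ = GL_n(ℂ)` with trivial Galois action, `ᴸG = GL_n(ℂ) × Γ_F`.
Ref: Borel, *Automorphic L-functions* (Corvallis 1979), §2.4, Example. [cite: Corvallis1979] -/
def gl (n : ℕ) : LGroupData F where
  rank := n
  dual := ⊤
  galAct := 1
  isOpen_ker := by simp

/-- `L` is *split* (the Galois action on `Ĝ` is trivial, `ᴸG = Ĝ × Γ_F`), as for a split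
group `G/F`.  Ref: Borel, *Automorphic L-functions* (Corvallis 1979), §2.4. [cite: Corvallis1979] -/
def IsSplit (L : LGroupData F) : Prop :=
  L.galAct = 1

/-- `LGroupData.gl F n` is split.  Ref: Borel, Corvallis 1979, §2.4. [cite: Corvallis1979, §2.4] -/
theorem isSplit_gl (n : ℕ) : (gl F n).IsSplit := rfl

/-- The subgroup `Z(Ĝ)^Γ ≤ Ĝ` of Galois-fixed central elements (compare Mathlib
`Subgroup.center`, `FixedPoints.subgroup`).
Ref: Kottwitz, *Stable trace formula: cuspidal tempered terms*, Duke Math. J. 51 (1984), §1;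
Gross–Reeder, Duke Math. J. 154 (2010), §3.2. [folklore] -/
def centerFixed (L : LGroupData F) : Subgroup L.dual where
  carrier := {g | g ∈ Subgroup.center L.dual ∧ ∀ σ, L.galAct σ g = g}
  one_mem' := ⟨Subgroup.one_mem _, fun σ => map_one _⟩
  mul_mem' ha hb := ⟨Subgroup.mul_mem _ ha.1 hb.1, fun σ => by rw [map_mul, ha.2, hb.2]⟩
  inv_mem' ha := ⟨Subgroup.inv_mem _ ha.1, fun σ => by rw [map_inv, ha.2]⟩

/-- Membership in `centerFixed`.  Ref: Gross–Reeder, Duke Math. J. 154 (2010), §3.2. [folklore] -/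
theorem mem_centerFixed_iff (L : LGroupData F) (g : L.dual) :
    g ∈ L.centerFixed ↔ g ∈ Subgroup.center L.dual ∧ ∀ σ, L.galAct σ g = g :=
  Iff.rfl

/-- Components of a conjugate `(g, 1) x (g, 1)⁻¹` in `Ĝ ⋊ Γ_F` when the `Γ_F`-component of `x`
acts trivially on `Ĝ`: `((g,1) x (g,1)⁻¹).left = g * x.left * g⁻¹`.
Ref: Borel, *Automorphic L-functions* (Corvallis 1979), §2.4. [cite: Corvallis1979] -/
theorem left_inl_mul_mul_inl_inv {L : LGroupData F} (g : L.dual) (x : L.LGroup)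
    (hx : L.galAct x.right = 1) :
    (SemidirectProduct.inl g * x * (SemidirectProduct.inl g)⁻¹).left = g * x.left * g⁻¹ := by
  simp [hx]

/-- The `Γ_F`-component of `(g, 1) x (g, 1)⁻¹` is that of `x`.
Ref: Borel, *Automorphic L-functions* (Corvallis 1979), §2.4. [cite: Corvallis1979] -/
theorem right_inl_mul_mul_inl_inv {L : LGroupData F} (g : L.dual) (x : L.LGroup) :
    (SemidirectProduct.inl g * x * (SemidirectProduct.inl g)⁻¹).right = x.right := by
  simp

end LGroupData

end LGroup

/-! ### Algebraic homomorphisms `SL₂(ℂ) → Ĝ` -/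

/-- A homomorphism `θ : SL₂(ℂ) → H ≤ GL_N(ℂ)` is *polynomial* (a morphism of algebraic groups):
each matrix entry of `θ s` is a fixed complex polynomial in the four entries of `s`.
Ref: Borel, *Linear algebraic groups*, §1.6; Gross–Reeder, Duke Math. J. 154 (2010), §3.1. [folklore] -/
def IsPolynomialHom {N : ℕ} {H : Subgroup (GL (Fin N) ℂ)} (θ : SL(2, ℂ) →* H) : Prop :=
  ∀ i j : Fin N, ∃ p : MvPolynomial (Fin 2 × Fin 2) ℂ, ∀ s : SL(2, ℂ),
    ((θ s : GL (Fin N) ℂ) : Matrix (Fin N) (Fin N) ℂ) i j =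
      MvPolynomial.eval (fun ij => (s : Matrix (Fin 2) (Fin 2) ℂ) ij.1 ij.2) p

/-- The trivial homomorphism is polynomial (constant polynomials).
Ref: Borel, *Linear algebraic groups*, §1.6. [folklore] -/
theorem IsPolynomialHom.one {N : ℕ} {H : Subgroup (GL (Fin N) ℂ)} :
    IsPolynomialHom (1 : SL(2, ℂ) →* H) := fun i j =>
  ⟨MvPolynomial.C ((1 : Matrix (Fin N) (Fin N) ℂ) i j), fun s => by simp⟩

/-- A conjugate of a polynomial homomorphism is polynomial (the entries of `g M g⁻¹` are linear
combinations of the entries of `M`).  Ref: Borel, *Linear algebraic groups*, §1.6. [folklore] -/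
theorem IsPolynomialHom.conj {N : ℕ} {H : Subgroup (GL (Fin N) ℂ)} {θ : SL(2, ℂ) →* H}
    (h : IsPolynomialHom θ) (g : H) :
    IsPolynomialHom ((MulAut.conj g).toMonoidHom.comp θ) := by
  classical
  choose p hp using h
  intro i j
  refine ⟨∑ l, (∑ k, MvPolynomial.C (((g : GL (Fin N) ℂ) : Matrix (Fin N) (Fin N) ℂ) i k) *
    p k l) * MvPolynomial.C ((((g⁻¹ : H) : GL (Fin N) ℂ) : Matrix (Fin N) (Fin N) ℂ) l j),
    fun s => ?_⟩
  simp only [MonoidHom.coe_comp, MulEquiv.coe_toMonoidHom, Function.comp_apply,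
    MulAut.conj_apply, Subgroup.coe_mul, Units.val_mul, Matrix.mul_apply, map_sum, map_mul,
    MvPolynomial.eval_C, hp]

/-! ### L-parameters -/

section LParameter

variable {F : Type*} [Field F] [ValuativeRel F] [TopologicalSpace F] [IsNonarchimedeanLocalField F]

/-- An **L-parameter** for the L-group datum `L` (in `SL₂`-form): a homomorphism
`φ : W_F → ᴸG = Ĝ ⋊ Γ_F` compatible with the projections to `Γ_F` (`rightHom_φ`), *continuous*
in the sense that it is the canonical section `w ↦ (1, w)` on some open subgroup of inertia
(`exists_isOpen`; `Ĝ` carries the complex topology and `Γ_F` acts through a finite quotient, so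
this is continuity of `W_F → ᴸG`), *Frobenius-semisimple* (`frobSemisimple`: any power
`(φ w)^m` whose `Γ_F`-component acts trivially on `Ĝ` has semisimple `Ĝ`-component), together
with an algebraic homomorphism `θ : SL₂(ℂ) → Ĝ` (`isPolynomial_θ`) commuting with the image
of `φ` (`comm`).  Relevance (Borel §8.2(ii)) is not imposed.
Ref: Borel, *Automorphic L-functions* (Corvallis 1979), §8.2; Gross–Reeder, *Duke Math. J.*
154 (2010), §3.1; Kaletha, *The local Langlands conjectures for non-quasi-split groups*
(2016), §5.1. [cite: Corvallis1979] -/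
structure LParameter (L : LGroupData F) where
  /-- The homomorphism `W_F → ᴸG`. -/
  φ : GaloisRepresentations.WeilGroup F →* L.LGroup
  /-- The algebraic homomorphism `SL₂(ℂ) → Ĝ` (Deligne's `SL₂`, carrying the monodromy). -/
  θ : SL(2, ℂ) →* L.dual
  /-- `φ` lies over the inclusion `W_F → Γ_F`. -/
  rightHom_φ : ∀ w, (φ w).right = GaloisRepresentations.WeilGroup.toAbsGalois F w
  /-- The images of `φ` and `θ` commute. -/
  comm : ∀ w s, φ w * SemidirectProduct.inl (θ s) = SemidirectProduct.inl (θ s) * φ w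
  /-- Continuity: `φ` is the canonical section on an open subgroup of inertia. -/
  exists_isOpen : ∃ U : Subgroup (GaloisRepresentations.WeilGroup F), U ≤ GaloisRepresentations.WeilGroup.inertia F ∧
    IsOpen (U : Set (GaloisRepresentations.WeilGroup F)) ∧
      ∀ u ∈ U, φ u = SemidirectProduct.inr (GaloisRepresentations.WeilGroup.toAbsGalois F u)
  /-- `θ` is a morphism of algebraic groups. -/
  isPolynomial_θ : IsPolynomialHom θ
  /-- Frobenius-semisimplicity of `φ`. -/
  frobSemisimple : ∀ (w : GaloisRepresentations.WeilGroup F) (m : ℕ), 0 < m → L.galAct ((φ w) ^ m).right = 1 →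
    Module.End.IsSemisimple
      (Matrix.toLin' ((((φ w) ^ m).left : GL (Fin L.rank) ℂ) : Matrix (Fin L.rank) (Fin L.rank) ℂ))

namespace LParameter

variable {L : LGroupData F}

/-- **Conjugation** of an L-parameter by `g ∈ Ĝ`: `(φ, θ) ↦ ((g,1) φ (g,1)⁻¹, g θ g⁻¹)`.  The open
subgroup of inertia witnessing continuity is intersected with the preimage of the (open) kernel
of the Galois action, using `WeilGroup.continuous_toAbsGalois_holds`.
Ref: Borel, *Automorphic L-functions* (Corvallis 1979), §8.2; Gross–Reeder, Duke Math. J. 154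
(2010), §3.1. [cite: Corvallis1979] -/
def conj (φ : LParameter L) (g : L.dual) : LParameter L where
  φ := (MulAut.conj (SemidirectProduct.inl g : L.LGroup)).toMonoidHom.comp φ.φ
  θ := (MulAut.conj g).toMonoidHom.comp φ.θ
  rightHom_φ w := by simp [φ.rightHom_φ w]
  comm w s := by
    simp only [MonoidHom.coe_comp, MulEquiv.coe_toMonoidHom, Function.comp_apply,
      MulAut.conj_apply, map_mul, map_inv, mul_assoc, inv_mul_cancel_left, mul_right_inj]
    rw [← mul_assoc, ← mul_assoc, φ.comm w s]
  exists_isOpen := by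
    obtain ⟨U, hU, hUo, hφ⟩ := φ.exists_isOpen
    refine ⟨U ⊓ L.galAct.ker.comap (GaloisRepresentations.WeilGroup.toAbsGalois F), inf_le_left.trans hU,
      hUo.inter (L.isOpen_ker.preimage (GaloisRepresentations.WeilGroup.continuous_toAbsGalois_holds F)), fun u hu => ?_⟩
    have h1 := hφ u hu.1
    have h2 : L.galAct (GaloisRepresentations.WeilGroup.toAbsGalois F u) = 1 := hu.2
    simp only [MonoidHom.coe_comp, MulEquiv.coe_toMonoidHom, Function.comp_apply,
      MulAut.conj_apply, h1]
    ext <;> simp [h2]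
  isPolynomial_θ := φ.isPolynomial_θ.conj g
  frobSemisimple w m hm h := by
    simp only [MonoidHom.coe_comp, MulEquiv.coe_toMonoidHom, Function.comp_apply,
      MulAut.conj_apply, _root_.conj_pow, LGroupData.right_inl_mul_mul_inl_inv] at h ⊢
    rw [LGroupData.left_inl_mul_mul_inl_inv g _ h]
    have := (isSemisimple_toLin'_units_conj_iff (g : GL (Fin L.rank) ℂ) _).mpr
      (φ.frobSemisimple w m hm h)
    simpa only [Subgroup.coe_mul, Subgroup.coe_inv, Units.val_mul] using this

/-- Unfolding lemma for the Weil-group part of a conjugate parameter.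
Ref: Borel, *Automorphic L-functions* (Corvallis 1979), §8.2. [cite: Corvallis1979] -/
@[simp] theorem conj_φ_apply (φ : LParameter L) (g : L.dual) (w : GaloisRepresentations.WeilGroup F) :
    (φ.conj g).φ w = SemidirectProduct.inl g * φ.φ w * (SemidirectProduct.inl g)⁻¹ :=
  rfl

/-- Unfolding lemma for the `SL₂`-part of a conjugate parameter.
Ref: Borel, *Automorphic L-functions* (Corvallis 1979), §8.2. [cite: Corvallis1979] -/
@[simp] theorem conj_θ_apply (φ : LParameter L) (g : L.dual) (s : SL(2, ℂ)) :
    (φ.conj g).θ s = g * φ.θ s * g⁻¹ :=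
  rfl

/-- Two L-parameters are **equivalent** if they are conjugate under `Ĝ`.
Ref: Borel, *Automorphic L-functions* (Corvallis 1979), §8.2; Gross–Reeder, Duke Math. J. 154
(2010), §3.1. [cite: Corvallis1979] -/
def IsEquiv (φ₁ φ₂ : LParameter L) : Prop :=
  ∃ g : L.dual, φ₂ = φ₁.conj g

/-- Two L-parameters with the same `φ` and `θ` are equal.
Ref: Borel, *Automorphic L-functions* (Corvallis 1979), §8.2. [cite: Corvallis1979] -/
@[ext] theorem ext {φ₁ φ₂ : LParameter L} (hφ : φ₁.φ = φ₂.φ) (hθ : φ₁.θ = φ₂.θ) : φ₁ = φ₂ := by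
  obtain ⟨φ, θ, _, _, _, _, _⟩ := φ₁
  obtain ⟨φ', θ', _, _, _, _, _⟩ := φ₂
  simp only at hφ hθ
  subst hφ hθ
  rfl

/-- Conjugating by `1` does nothing.  Ref: Borel, Corvallis 1979, §8.2. [cite: Corvallis1979, §8.2] -/
@[simp] theorem conj_one (φ : LParameter L) : φ.conj 1 = φ := by
  refine LParameter.ext (MonoidHom.ext fun w => ?_) (MonoidHom.ext fun s => ?_)
  · simp
  · simp

/-- Conjugation is an action: `(φ.conj g).conj h = φ.conj (h * g)`.
Ref: Borel, Corvallis 1979, §8.2. [cite: Corvallis1979, §8.2] -/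
theorem conj_conj (φ : LParameter L) (g h : L.dual) : (φ.conj g).conj h = φ.conj (h * g) := by
  refine LParameter.ext (MonoidHom.ext fun w => ?_) (MonoidHom.ext fun s => ?_)
  · simp [mul_assoc]
  · simp [mul_assoc]

/-- `IsEquiv` is reflexive.  Ref: Borel, Corvallis 1979, §8.2. [cite: Corvallis1979, §8.2] -/
protected theorem IsEquiv.refl (φ : LParameter L) : IsEquiv φ φ :=
  ⟨1, (conj_one φ).symm⟩

/-- `IsEquiv` is symmetric.  Ref: Borel, Corvallis 1979, §8.2. [cite: Corvallis1979, §8.2] -/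
protected theorem IsEquiv.symm {φ₁ φ₂ : LParameter L} (h : IsEquiv φ₁ φ₂) : IsEquiv φ₂ φ₁ := by
  obtain ⟨g, rfl⟩ := h
  exact ⟨g⁻¹, by rw [conj_conj, inv_mul_cancel, conj_one]⟩

/-- `IsEquiv` is transitive.  Ref: Borel, Corvallis 1979, §8.2. [cite: Corvallis1979, §8.2] -/
protected theorem IsEquiv.trans {φ₁ φ₂ φ₃ : LParameter L} (h : IsEquiv φ₁ φ₂)
    (h' : IsEquiv φ₂ φ₃) : IsEquiv φ₁ φ₃ := by
  obtain ⟨g, rfl⟩ := h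
  obtain ⟨g', rfl⟩ := h'
  exact ⟨g' * g, conj_conj φ₁ g g'⟩

variable (L) in
/-- The setoid of `Ĝ`-conjugacy on L-parameters; its quotient is the set `Φ(G)` of equivalence
classes of parameters.  Ref: Borel, *Automorphic L-functions* (Corvallis 1979), §8.2. [cite: Corvallis1979] -/
def setoid : Setoid (LParameter L) where
  r := IsEquiv
  iseqv := ⟨IsEquiv.refl, IsEquiv.symm, IsEquiv.trans⟩

/-- An L-parameter is **unramified** if `φ` is the canonical section on all of inertia and the
`SL₂`-part is trivial.  Ref: Borel, *Automorphic L-functions* (Corvallis 1979), §§9.5, 10.4. [cite: Corvallis1979] -/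
def IsUnramified (φ : LParameter L) : Prop :=
  (∀ u ∈ GaloisRepresentations.WeilGroup.inertia F, φ.φ u = SemidirectProduct.inr (GaloisRepresentations.WeilGroup.toAbsGalois F u)) ∧
    φ.θ = 1

/-- An L-parameter is **bounded** (or *tempered*) if the projection of `φ(W_F)` to `Ĝ ≤ GL_N(ℂ)`
is relatively compact.  Ref: Borel, *Automorphic L-functions* (Corvallis 1979), §10.3(4);
Gross–Reeder, Duke Math. J. 154 (2010), §3.2. [cite: Corvallis1979] -/
def IsBounded (φ : LParameter L) : Prop :=
  IsCompact (closure (Set.range fun w : GaloisRepresentations.WeilGroup F => ((φ.φ w).left : GL (Fin L.rank) ℂ)))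

/-- The **centralizer** `S_φ = Cent(φ, Ĝ) ≤ Ĝ` of an L-parameter: the elements of `Ĝ` commuting
(inside `ᴸG`) with all `φ w` and with all `θ s`.
Ref: Gross–Reeder, Duke Math. J. 154 (2010), §3.2 (`A_φ`); Kaletha (2016), §5.1. [cite: Kaletha2016] -/
def centralizerGroup (φ : LParameter L) : Subgroup L.dual where
  carrier := {g | (∀ w, SemidirectProduct.inl g * φ.φ w = φ.φ w * SemidirectProduct.inl g) ∧
    ∀ s, g * φ.θ s = φ.θ s * g}
  one_mem' := ⟨fun w => by simp, fun s => by simp⟩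
  mul_mem' {a b} ha hb := ⟨fun w => by rw [map_mul, mul_assoc, hb.1, ← mul_assoc, ha.1, mul_assoc],
    fun s => by rw [mul_assoc, hb.2, ← mul_assoc, ha.2, mul_assoc]⟩
  inv_mem' {a} ha := ⟨fun w => by
      rw [map_inv, inv_mul_eq_iff_eq_mul, ← mul_assoc, ha.1, mul_assoc, mul_inv_cancel, mul_one],
    fun s => by rw [inv_mul_eq_iff_eq_mul, ← mul_assoc, ha.2, mul_assoc, mul_inv_cancel, mul_one]⟩

/-- Membership in `S_φ`.  Ref: Gross–Reeder, Duke Math. J. 154 (2010), §3.2. [folklore] -/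
theorem mem_centralizerGroup_iff (φ : LParameter L) (g : L.dual) :
    g ∈ φ.centralizerGroup ↔
      (∀ w, SemidirectProduct.inl g * φ.φ w = φ.φ w * SemidirectProduct.inl g) ∧
        ∀ s, g * φ.θ s = φ.θ s * g :=
  Iff.rfl

/-- `φ = φ.conj g` for `g ∈ S_φ`.  Ref: Gross–Reeder, Duke Math. J. 154 (2010), §3.2. [folklore] -/
theorem conj_eq_self_of_mem_centralizerGroup (φ : LParameter L) {g : L.dual}
    (hg : g ∈ φ.centralizerGroup) : φ.conj g = φ := by
  refine LParameter.ext (MonoidHom.ext fun w => ?_) (MonoidHom.ext fun s => ?_)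
  · rw [conj_φ_apply, hg.1 w, mul_inv_cancel_right]
  · rw [conj_θ_apply, hg.2, mul_inv_cancel_right]

/-- `Z(Ĝ)^Γ ≤ S_φ`.  Ref: Kottwitz, Duke Math. J. 51 (1984), §1; Gross–Reeder (2010), §3.2. [cite: GrossReeder2010] -/
theorem centerFixed_le_centralizerGroup (φ : LParameter L) :
    L.centerFixed ≤ φ.centralizerGroup := by
  intro g hg
  have hc := Subgroup.mem_center_iff.mp hg.1
  refine ⟨fun w => ?_, fun s => (hc _).symm⟩
  ext
  · simp [hg.2, hc]
  · simp

/-- An L-parameter is **discrete** if `S_φ / Z(Ĝ)^Γ` is finite (equivalently, the image of `φ`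
lies in no proper relevant parabolic / Levi subgroup of `ᴸG`).
Ref: Gross–Reeder, Duke Math. J. 154 (2010), §3.2; Kaletha (2016), §5.1. [cite: Kaletha2016] -/
def IsDiscrete (φ : LParameter L) : Prop :=
  Finite (φ.centralizerGroup ⧸ L.centerFixed.subgroupOf φ.centralizerGroup)

/-- The **component group** `π₀(S_φ) = S_φ / S_φ°` of the centralizer of an L-parameter, where
`S_φ ≤ Ĝ ≤ GL_N(ℂ)` carries the subspace topology and `S_φ°` is its identity component
(Mathlib `Subgroup.connectedComponentOfOne`, normal by `connectedComponentOfOne_normal`).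
Ref: Arthur, *Unipotent automorphic representations: conjectures*, Astérisque 171–172 (1989),
§1; Gross–Reeder, Duke Math. J. 154 (2010), §3.2; Kaletha (2016), §4.7 / §5.1. [cite: Kaletha2016] -/
def componentGroup (φ : LParameter L) : Type :=
  φ.centralizerGroup ⧸ Subgroup.connectedComponentOfOne φ.centralizerGroup

/-- The group structure on `π₀(S_φ)` (a quotient group).  Ref: Gross–Reeder (2010), §3.2. [cite: GrossReeder2010] -/
instance instGroupComponentGroup (φ : LParameter L) : Group φ.componentGroup :=
  inferInstanceAs <|
    Group (φ.centralizerGroup ⧸ Subgroup.connectedComponentOfOne φ.centralizerGroup)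

end LParameter

/-- An **enhanced L-parameter** `(φ, ρ)`: an L-parameter together with an irreducible
finite-dimensional complex representation `ρ` of the component group `π₀(S_φ)`.
(Kaletha's rigid refinement replaces `π₀(S_φ)` by `π₀(S_φ^+)`; omitted in v0.)
Ref: Vogan, *The local Langlands conjecture* (1993), §4; Gross–Reeder, Duke Math. J. 154
(2010), §3.2; Kaletha (2016), §5.1. [cite: Kaletha2016] -/
structure EnhancedLParameter (L : LGroupData F) extends LParameter L where
  /-- The representation space of the enhancement. -/
  W : Type
  /-- `W` is an additive commutative group. -/
  [addCommGroup : AddCommGroup W]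
  /-- `W` is a complex vector space. -/
  [module : Module ℂ W]
  /-- `W` is finite-dimensional. -/
  [finite : FiniteDimensional ℂ W]
  /-- The representation of `π₀(S_φ)` on `W`. -/
  ρ : Representation ℂ toLParameter.componentGroup W
  /-- `ρ` is irreducible. -/
  irreducible : ρ.IsIrreducible

attribute [instance] EnhancedLParameter.addCommGroup EnhancedLParameter.module
  EnhancedLParameter.finite

/-! ### The case of `GL_n` -/

variable (F) in
/-- The setoid of isomorphism on Frobenius-semisimple `n`-dimensional complex Weil–Deligne
representations of `W_F` (on the fixed space `Fin n → ℂ`), using the accepted predicate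
`Literature.NumberTheory.GaloisRepresentations.WeilDeligneRep.IsEquivalent`.
Ref: Deligne, *Les constantes des équations fonctionnelles* (1973), §8.4; Tate, *Number
theoretic background* (Corvallis 1979), (4.1.3). [cite: Corvallis1979] -/
def frobSemisimpleWDSetoid (n : ℕ) :
    Setoid {r : GaloisRepresentations.WeilDeligneRep F ℂ (Fin n → ℂ) // r.IsFrobSemisimple} where
  r r r' := r.1.IsEquivalent r'.1
  iseqv := ⟨fun r => GaloisRepresentations.WeilDeligneRep.IsEquivalent.refl r.1, fun h => h.symm, fun h h' => h.trans h'⟩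

namespace LParameter

variable (F) in
/-- **L-parameters for `GL_n` are Frobenius-semisimple Weil–Deligne representations**:
`Ĝ`-conjugacy classes of L-parameters `W_F × SL₂(ℂ) → GL_n(ℂ)` are in canonical bijection with
isomorphism classes of Frobenius-semisimple `n`-dimensional Weil–Deligne representations
(`(ρ, θ) ↦ (ρ ⊗ θ(diag(‖w‖^{1/2}, ‖w‖^{-1/2})), dθ(e))`, Jacobson–Morozov for the inverse).
As prescribed by the outline (v0), only the existence of a bijection between the two quotients is
asserted here; the canonical map is not constructed.  Named fact (a `Prop`; consumers take
`(h : LParameter.gl_equiv_weilDeligneRep F n)`).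
Ref: Gross–Reeder, Duke Math. J. 154 (2010), §2, Prop. 2.2; Deligne, Antwerp II (1973), §8;
Kaletha (2016), §5.1. [cite: GrossReeder2010, §2 Prop. 2.2] -/
def gl_equiv_weilDeligneRep (n : ℕ) : Prop :=
  Nonempty (Quotient (LParameter.setoid (LGroupData.gl F n)) ≃
    Quotient (frobSemisimpleWDSetoid F n))

variable (F) in
/-- For `GL_n` the component groups `π₀(S_φ)` are trivial: the centralizer of any L-parameter in
`GL_n(ℂ)` is a product of general linear groups, hence connected.  Named fact (a `Prop`;
consumers take `(h : LParameter.componentGroup_subsingleton_of_gl F n)`).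
Ref: Gross–Reeder, Duke Math. J. 154 (2010), §3.2; Kaletha (2016), §5.1, Example. [cite: Kaletha2016, §5.1 Example] -/
def componentGroup_subsingleton_of_gl (n : ℕ) : Prop :=
  ∀ φ : LParameter (LGroupData.gl F n), Subsingleton φ.componentGroup

end LParameter

end LParameter

end Automorphic

end Literature.NumberTheory.Automorphic
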